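import Summits.HodgeConjecture.HodgeConjecture.Theses.TropicalWeilObstruction
import Summits.HodgeConjecture.HodgeConjecture.Theorems.TropicalWeilObstructionTropicalHodgeBoundRationalHodgeCoordinates
import Summits.HodgeConjecture.HodgeConjecture.Theorems.TropicalWeilObstructionTropicalHodgeBoundHermitianPairing
import HarnessLib

/-!
# Crux `TropicalWeilVanishing` (K1 of route `TropicalWeilObstruction`): the calibration cone —
# what EFFECTIVITY alone gives toward K1

Route `HodgeConjecture/TropicalWeilObstruction` is a REFUTATION route (Kontsevich's tropical test, negative
branch); this file is negation-sink bookkeeping of the cell `pub-hodge-tropical` (seat tropical-2) and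
decides nothing about the Hodge conjecture, in either direction, and nothing about the OPEN crux K1.

K1 (`TropicalWeilVanishing`, stmt-HodgeConjecture-18478) says that on a very general principally polarised
tropical Weil eightfold `ℝ⁸/Qℤ⁸` every effective tropical `4`-cycle `Z` has `W(Z) = 0`; by the landed K3
chain this is equivalent to "`cyc Z ∈ ℚ·θ₄(Q)`" (`tropicalWeilVanishing_iff_thetaLine`): in the rational
coordinates `cyc Z = q₀ θ₄(Q) + q₁ Re w(Q) + q₂ Im w(Q)` of `stub_rationalHodgeCoordinates`, K1 ⟺ `q₁ = q₂ = 0`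
for every effective `Z`. This file records the one constraint on `(q₀, q₁, q₂)` that follows from
EFFECTIVITY (`w_σ > 0`, `a_σ > 0`) alone, by the triangle inequality — the tropical **calibration
inequality** `|W(Z)| ≤ μ(Z)`, `μ(Z) = Σ_σ w_σ a_σ |η_σ|²` the value on `cyc Z` of the positive hermitian
functional `dz ⊗ dz̄`:

* `norm_weilFunctional_le_weilMass` — `‖W(Z)‖ ≤ Σ_σ w_σ a_σ ‖η_σ‖²` for every effective tropical `n`-cycle on
  every `ℝ²ⁿ/Qℤ²ⁿ` (general `n`, any `Q`; `latticeVolume_pos`: `a_σ > 0`).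
* `effective_cyc_mem_calibrationCone` — **the cone.** For `Q ≻ 0`, `QJ = JQ`, `IsWeilGeneric 4 Q` and every
  effective tropical `4`-cycle `Z` on `ℝ⁸/Qℤ⁸`: `cyc Z = q₀ θ₄(Q) + q₁ Re w(Q) + q₂ Im w(Q)` with `q ∈ ℚ³`,
  `0 ≤ q₀` and `64 (q₁² + q₂²) ≤ q₀²`. I.e. the classes of EFFECTIVE tropical `4`-cycles lie in the closed
  round cone of aperture `4^{1-n}` (`n = 4`) about the theta ray inside the `3`-space `⟨θ₄, Re w, Im w⟩_ℚ`;
  K1 is the statement that they lie on its axis. Ingredients: K3's `stub_rationalHodgeCoordinates`,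
  `W = Ŵ ∘ cyc`, `Ŵ(θ₄) = 0`, and the helper file `…TropicalHodgeBoundHermitianPairing.lean`
  (`M̂(cyc Z) = μ(Z)`, `M̂(θ₄(Q)) = det (P Q Pᴴ) > 0`, `M̂(Re w) = M̂(Im w) = 0`, `Ŵ(Re w) = 8 det (P Q Pᴴ)`,
  `Ŵ(Im w) = -8i det (P Q Pᴴ)`), so that `|W(Z)| = 8 det(PQPᴴ)|q₁ - iq₂| ≤ μ(Z) = q₀ det(PQPᴴ)`.

HONEST STATUS. The cone is weak (it does not exclude any `W ≠ 0` class near the axis) and is not evidence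
for or against K1; it is a K1-side statement at the level of CLASSES that uses positivity of the weights (the
flat rung's `…NoLift` lemma uses positivity at the level of types), recorded so that seed certificates
(K1-SCOPE §4A) and obstruction mechanisms (§4B) can be read against it. Prior art:
the same inequality, with the same constant `4^{1-n}`, is "Thm C_n (calibration)" of the prior programme's
unpublished tropical-Weil-torus notes (stockroom `reserve/prior-2001/…/Hodge_NegTropicalWeilTorus_TWTCalibration.lean`,
interface form; nothing is imported from there). No definition, no named fact, no sorry.

## References
* [Zharkov2020TropicalWeil] I. Zharkov, Tropical abelian varieties, Weil classes and the Hodge conjecture,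
  arXiv:2002.02347, §2 (pp. 2–4).
* [MikhalkinZharkov2014Eigenwave] G. Mikhalkin, I. Zharkov, Tropical eigenwave and intermediate Jacobians,
  Prop. 4.3.
-/

set_option linter.dupNamespace false

noncomputable section

open scoped BigOperators
open Matrix
open Literature.AlgebraicGeometry.Tropical
open Summit.HodgeConjecture.HodgeConjecture.Theorems.TropicalHodgeBound

namespace Summit.HodgeConjecture.HodgeConjecture.Theorems.TropicalWeilVanishing

/-! ## §0 Display-only notation (the K3 skeleton's local definitions, verbatim bodies; nothing is defined) -/

/-- `P = [1 | i·1]`, the `n × 2n` matrix of `dz₁ ∧ … ∧ dz_n`. -/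
local notation3 (prettyPrint := false) "𝐏⟦" n "⟧" =>
  (Matrix.of fun (k : Fin n) (a : Fin (2 * n)) =>
    (if (a : ℕ) = (k : ℕ) then (1 : ℂ) else 0) + (if (a : ℕ) = (k : ℕ) + n then Complex.I else 0))

/-- The skeleton's `dzCoord n S`. -/
local notation3 (prettyPrint := false) "dz⟦" n "⟧" S:max =>
  (Matrix.det (Matrix.of fun k a : Fin n =>
    (if (S a : ℕ) = (k : ℕ) then (1 : ℂ) else 0) + (if (S a : ℕ) = (k : ℕ) + n then Complex.I else 0)))

/-- The skeleton's `weilPairing n C` (the value `Ŵ(C)` of `dz ⊗ dz`). -/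
local notation3 (prettyPrint := false) "Ŵ⟦" n "⟧" C:max =>
  (∑ S : Fin n → Fin (2 * n), ∑ S' : Fin n → Fin (2 * n),
    dz⟦n⟧ S * dz⟦n⟧ S' / ((Nat.factorial n : ℂ) ^ 2) * ((C S S' : ℝ) : ℂ))

/-- NEW display-only notation: the hermitian pairing `M̂(C)` (the value of `dz ⊗ dz̄` on `C`). -/
local notation3 (prettyPrint := false) "M̂⟦" n "⟧" C:max =>
  (∑ S : Fin n → Fin (2 * n), ∑ S' : Fin n → Fin (2 * n),
    dz⟦n⟧ S * (starRingEnd ℂ) (dz⟦n⟧ S') / ((Nat.factorial n : ℂ) ^ 2) * ((C S S' : ℝ) : ℂ))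

/-- The skeleton's `thetaClass n Q`. -/
local notation3 (prettyPrint := false) "θ⟦" n "⟧" Q:max =>
  (fun S S' : Fin n → Fin (2 * n) => Matrix.det (Matrix.submatrix Q S S'))

/-- The skeleton's `omegaFrame n` (`Ω = Pᴴ`). -/
local notation3 (prettyPrint := false) "Ω⟦" n "⟧" =>
  (Matrix.of fun (a : Fin (2 * n)) (b : Fin n) =>
    (if (a : ℕ) = (b : ℕ) then (1 : ℂ) else 0) - (if (a : ℕ) = (b : ℕ) + n then Complex.I else 0))

/-- The skeleton's `weilClassC n Q` (`w(Q) = (⋀ⁿQ ⊗ 1)(Ω ⊗ Ω)`). -/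
local notation3 (prettyPrint := false) "wC⟦" n "⟧" Q:max =>
  (fun S S' : Fin n → Fin (2 * n) =>
    Matrix.det (Matrix.submatrix (Matrix.map Q ((↑) : ℝ → ℂ) * Ω⟦n⟧) S id) *
      Matrix.det (Matrix.submatrix (Ω⟦n⟧) S' id))

/-- The skeleton's `weilClassRe n Q` (`w₁ = Re w`). -/
local notation3 (prettyPrint := false) "wRe⟦" n "⟧" Q:max =>
  (fun S S' : Fin n → Fin (2 * n) => Complex.re ((wC⟦n⟧ Q) S S'))

/-- The skeleton's `weilClassIm n Q` (`w₂ = Im w`). -/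
local notation3 (prettyPrint := false) "wIm⟦" n "⟧" Q:max =>
  (fun S S' : Fin n → Fin (2 * n) => Complex.im ((wC⟦n⟧ Q) S S'))

/-! ## §1 The calibration inequality `‖W(Z)‖ ≤ μ(Z)` (general `n`, any `Q`) -/

section General

variable {n : ℕ}

/-- The lattice-normalised volume `a_σ = det T_σ / p!` of a cell is positive (`det T_σ > 0`).
[cite: MikhalkinZharkov2014Eigenwave, Prop. 4.3] -/
theorem latticeVolume_pos {g p : ℕ} (c : TropicalCell g p) : 0 < c.latticeVolume :=
  div_pos c.edgeCoeff_det_pos (by exact_mod_cast Nat.factorial_pos p)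

/-- **Calibration inequality (cell form).** For every effective tropical `n`-cycle `Z` on `ℝ²ⁿ/Q·ℤ²ⁿ`,
`‖W(Z)‖ = ‖Σ_σ w_σ a_σ η_σ²‖ ≤ Σ_σ w_σ a_σ ‖η_σ‖² =: μ(Z)` — the triangle inequality, using only that the
weights `w_σ` and cell volumes `a_σ` are positive (the equality case — all `η_σ²` on one real ray, "calibrated"
cycles — is not needed and not proved here). [cite: Zharkov2020TropicalWeil, §2] -/
theorem norm_weilFunctional_le_weilMass {Q : Matrix (Fin (2 * n)) (Fin (2 * n)) ℝ}
    (Z : TropicalTorusCycle (2 * n) n Q) :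
    ‖weilFunctional Z‖ ≤ ∑ σ, ((Z.cell σ).weight : ℝ) * (Z.cell σ).latticeVolume *
        ‖frameComplexDet n (Z.cell σ).frame‖ ^ 2 := by
  unfold weilFunctional
  refine (norm_sum_le _ _).trans (le_of_eq (Finset.sum_congr rfl fun σ _ => ?_))
  rw [norm_mul, norm_mul, norm_pow, Complex.norm_natCast, Complex.norm_real,
    Real.norm_of_nonneg (latticeVolume_pos _).le]

end General

/-! ## §2 The calibration cone at a very general Weil period (`n = 4`) -/

/-- `Ŵ` is additive and homogeneous: `Ŵ(Σ-combination)` splits (kernel form). [folklore] -/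
theorem weilPairing_lincomb (q : Fin 3 → ℚ) (A B C : (Fin 4 → Fin (2 * 4)) → (Fin 4 → Fin (2 * 4)) → ℝ) :
    Ŵ⟦4⟧ (((q 0 : ℚ) : ℝ) • A + ((q 1 : ℚ) : ℝ) • B + ((q 2 : ℚ) : ℝ) • C) =
      (q 0 : ℂ) * Ŵ⟦4⟧ A + (q 1 : ℂ) * Ŵ⟦4⟧ B + (q 2 : ℂ) * Ŵ⟦4⟧ C := by
  simp only [Pi.add_apply, Pi.smul_apply, smul_eq_mul, Complex.ofReal_add, Complex.ofReal_mul,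
    Complex.ofReal_ratCast, mul_add, Finset.sum_add_distrib, Finset.mul_sum]
  congr 1; congr 1
  all_goals
    refine Finset.sum_congr rfl fun S _ => Finset.sum_congr rfl fun S' _ => ?_
    ring

/-- `M̂` is additive and homogeneous (kernel form). [folklore] -/
theorem hermPairing_lincomb (q : Fin 3 → ℚ) (A B C : (Fin 4 → Fin (2 * 4)) → (Fin 4 → Fin (2 * 4)) → ℝ) :
    M̂⟦4⟧ (((q 0 : ℚ) : ℝ) • A + ((q 1 : ℚ) : ℝ) • B + ((q 2 : ℚ) : ℝ) • C) =
      (q 0 : ℂ) * M̂⟦4⟧ A + (q 1 : ℂ) * M̂⟦4⟧ B + (q 2 : ℂ) * M̂⟦4⟧ C := by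
  simp only [Pi.add_apply, Pi.smul_apply, smul_eq_mul, Complex.ofReal_add, Complex.ofReal_mul,
    Complex.ofReal_ratCast, mul_add, Finset.sum_add_distrib, Finset.mul_sum]
  congr 1; congr 1
  all_goals
    refine Finset.sum_congr rfl fun S _ => Finset.sum_congr rfl fun S' _ => ?_
    ring

/-- **The calibration cone.** On a very general principally polarised tropical Weil eightfold `ℝ⁸/Qℤ⁸`
(`Q ≻ 0`, `QJ = JQ`, `IsWeilGeneric 4 Q`) the class of every EFFECTIVE tropical `4`-cycle `Z` has rational
coordinates `cyc Z = q₀ θ₄(Q) + q₁ Re w(Q) + q₂ Im w(Q)` (K3, `stub_rationalHodgeCoordinates`) satisfying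
`0 ≤ q₀` and `64 (q₁² + q₂²) ≤ q₀²`: `|W(Z)| = 8 det(P Q Pᴴ) · |q₁ - i q₂|` and
`μ(Z) = q₀ det(P Q Pᴴ)` with `det (P Q Pᴴ) > 0`, and `|W(Z)| ≤ μ(Z)`. The OPEN crux K1
(`TropicalWeilVanishing`) is the statement `q₁ = q₂ = 0` for every such `Z`
(`TropicalHodgeBound.tropicalWeilVanishing_iff_thetaLine`); this cone is all that positivity of the
weights gives by the triangle inequality, and is not evidence for or against K1.
[cite: Zharkov2020TropicalWeil, §2] [cite: MikhalkinZharkov2014Eigenwave, Prop. 4.3 and Thm. 5.4] -/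
theorem effective_cyc_mem_calibrationCone (Q : Matrix (Fin (2 * 4)) (Fin (2 * 4)) ℝ) (hQ : Q.PosDef)
    (hJ : Q * weilJ 4 = weilJ 4 * Q) (hgen : IsWeilGeneric 4 Q) (Z : TropicalTorusCycle (2 * 4) 4 Q) :
    ∃ q : Fin 3 → ℚ,
      TropicalTorusCycle.cyc Z = ((q 0 : ℚ) : ℝ) • θ⟦4⟧ Q + ((q 1 : ℚ) : ℝ) • wRe⟦4⟧ Q +
        ((q 2 : ℚ) : ℝ) • wIm⟦4⟧ Q ∧
      0 ≤ q 0 ∧ 64 * ((q 1) ^ 2 + (q 2) ^ 2) ≤ (q 0) ^ 2 := by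
  obtain ⟨q, hq⟩ := stub_rationalHodgeCoordinates Q hQ hJ hgen Z
  refine ⟨q, hq, ?_⟩
  have h4 : (0 : ℕ) < 4 := by norm_num
  -- the calibration inequality and the mass identity, then abbreviate `μ(Z)` and `D = det (P Q Pᴴ)`
  have hcal := norm_weilFunctional_le_weilMass Z
  have hM0 := hermPairing_cyc Q Z
  generalize hμ : (∑ σ, ((Z.cell σ).weight : ℝ) * (Z.cell σ).latticeVolume *
    ‖frameComplexDet 4 (Z.cell σ).frame‖ ^ 2) = μ at hcal hM0
  obtain ⟨hDre, hDim⟩ := det_frame_mul_map_mul_conjTranspose_pos Q hQ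
  -- `W(Z) = 8 D (q₁ - i q₂)` and `μ(Z) = q₀ D`
  have hW : weilFunctional Z = (8 : ℂ) * (𝐏⟦4⟧ * Q.map ((↑) : ℝ → ℂ) * (𝐏⟦4⟧)ᴴ).det *
      ((q 1 : ℂ) - Complex.I * (q 2 : ℂ)) := by
    rw [stub_weilFunctional_eq_pairing Q Z, hq, weilPairing_lincomb,
      weilPairing_thetaClass_eq_zero h4 Q hJ, weilPairing_weilClassRe_eq h4 Q,
      weilPairing_weilClassIm_eq h4 Q]
    norm_num
    ring
  have hM : ((μ : ℝ) : ℂ) = (q 0 : ℂ) * (𝐏⟦4⟧ * Q.map ((↑) : ℝ → ℂ) * (𝐏⟦4⟧)ᴴ).det := by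
    rw [← hM0, hq, hermPairing_lincomb, hermPairing_thetaClass_eq_det,
      hermPairing_weilClassRe_eq_zero h4 Q hJ, hermPairing_weilClassIm_eq_zero h4 Q hJ]
    ring
  generalize hD : (𝐏⟦4⟧ * Q.map ((↑) : ℝ → ℂ) * (𝐏⟦4⟧)ᴴ).det = D at hDre hDim hW hM
  obtain ⟨d, rfl⟩ : ∃ d : ℝ, (d : ℂ) = D := ⟨D.re, Complex.ext (by simp) (by simp [hDim])⟩
  rw [Complex.ofReal_re] at hDre
  -- the calibration inequality, in coordinates
  have hμq : μ = (q 0 : ℝ) * d := by exact_mod_cast hM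
  have hnormW : ‖weilFunctional Z‖ = 8 * d * Real.sqrt ((q 1 : ℝ) ^ 2 + (q 2 : ℝ) ^ 2) := by
    rw [hW, norm_mul, norm_mul, Complex.norm_real, Real.norm_of_nonneg hDre.le]
    have h8 : ‖(8 : ℂ)‖ = 8 := by simp
    rw [h8, Complex.norm_eq_sqrt_sq_add_sq]
    congr 2
    simp only [Complex.sub_re, Complex.ratCast_re, Complex.mul_re, Complex.I_re, zero_mul,
      Complex.ratCast_im, Complex.I_im, one_mul, sub_self, Complex.sub_im, Complex.mul_im, zero_add]
    ring
  have hq0 : 0 ≤ (q 0 : ℝ) := by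
    have h0 : 0 ≤ μ := le_trans (norm_nonneg _) hcal
    rw [hμq] at h0
    by_contra hneg
    push Not at hneg
    have : (q 0 : ℝ) * d < 0 := mul_neg_of_neg_of_pos hneg hDre
    linarith
  refine ⟨by exact_mod_cast hq0, ?_⟩
  have hineq : 8 * Real.sqrt ((q 1 : ℝ) ^ 2 + (q 2 : ℝ) ^ 2) ≤ (q 0 : ℝ) := by
    have h := hcal
    rw [hnormW, hμq] at h
    have h' : d * (8 * Real.sqrt ((q 1 : ℝ) ^ 2 + (q 2 : ℝ) ^ 2)) ≤ d * (q 0 : ℝ) := by linarith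
    exact le_of_mul_le_mul_left h' hDre
  have hsq : (8 * Real.sqrt ((q 1 : ℝ) ^ 2 + (q 2 : ℝ) ^ 2)) ^ 2 ≤ ((q 0 : ℚ) : ℝ) ^ 2 :=
    pow_le_pow_left₀ (by positivity) hineq 2
  rw [mul_pow, Real.sq_sqrt (by positivity)] at hsq
  have : (64 : ℝ) * ((q 1 : ℝ) ^ 2 + (q 2 : ℝ) ^ 2) ≤ (q 0 : ℝ) ^ 2 := by linarith
  exact_mod_cast this

end Summit.HodgeConjecture.HodgeConjecture.Theorems.TropicalWeilVanishing

end
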